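import Literature.NumberTheory.Connes2026.SemilocalCutoffScaleInvariance
import Literature.NumberTheory.Connes2026.ScalingOpTranslation
import HarnessLib

/-!
# Connes 1999 Thm VII.4, `k = ℚ`, `S = {∞, p}` — THE TRACE VALUE, REDUCED: moving the dilation `ϑ_{m log p}`
# onto the test function, hypothesis (V) of `AnnulusFamilyReduction` becomes the single classical identity
# `Σ_i ⟨e_i, ϑ(h) Q₀ e_i⟩ = log p · h(0)` over Hilbert bases of `L²(ℝ)_ev`

LABEL (line 1): RH-FREE literature (theorems only; NO definition, NO named fact).  bears_on: LADDER-RH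
W-C/W-P (C1 named-fact debt), cell `rh-crit`, sub-cell cc, overflow row O1 — fourteenth file of the "annulus
road" under `Connes1999_thm_VII_4_rat`.  WHAT THIS IS NOT: any claim about positivity, Weil's criterion or RH.

Sources.  A. Connes, Selecta Math. 5 (1999) [`Connes1999`], §VII Thm 4 and proof (29)–(33) (held text
`paper:arxiv-math_9811068`, p0013): the `p`-adic term `∫′_{ℚ_p^*} h(u⁻¹)|u|^{1/2} d^*u = Σ_k log p · p^{−|k|/2} g(k log p)`
comes from the trace `log p · g(k log p)` of each annulus piece; A. Connes, C. Consani (2021) [`ConnesConsani2021`], §4 (40).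

## What is proved

With `Q₀ = shellProj p⁻¹ 1`, `ϑ_s = scalingUnitary s`, `τ₀ = log p`:

* `inner_scalingOp_shellProj_scalingUnitary_eq` — `⟨f_i, ϑ(g) Q₀ Q₀ ϑ_{mτ₀} f_i⟩ = ⟨f'_i, ϑ(g(· − mτ₀)) Q₀ f'_i⟩` termwise
  along the transported Hilbert basis `f' = f.scalingConj (−mτ₀)` (`ϑ_{mτ₀} ϑ(g) = ϑ(g(· − mτ₀))`, `Q₀² = Q₀`);
* **`annulusValue_of_traceValue`** — if `Σ_i ⟨e_i, (ϑ(h) ∘ Q₀) e_i⟩ = log p · h(0)` for every translate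
  `h = g(· − s)` of `g` and every Hilbert basis `(e_i)` of `L²(ℝ)_ev` (the classical TRACE VALUE
  `Tr(ϑ(h) Q_{a,b})|_ev = h(0) log(b/a)` at `(a,b) = (1/p, 1)`), then hypothesis (V) of
  `Connes1999_thm_VII_4_rat_singleton_of_offShell` holds:
  `Σ_i ⟨f_i, (ϑ(g) ∘ Q₀ ∘ (Q₀ ∘ ϑ_{mτ₀})) f_i⟩ = log p · g(−mτ₀)` for all `m ∈ ℤ` and all Hilbert bases.

No instance, notation or attribute; no `def`.
-/

noncomputable section

open _root_.MeasureTheory Complex Set Filter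
open scoped Real Topology ComplexConjugate ENNReal InnerProductSpace

namespace Literature.NumberTheory.Connes2026

open Literature.NumberTheory.LFunctions Literature.Analysis.OperatorTheory
open Literature.NumberTheory.ConnesConsani
open Literature.NumberTheory.ConnesConsani2024
open Literature.NumberTheory.ConnesConsani2021 hiding cutoffProj cutoffProj_coeFn

variable (p : ℕ) [hp : Fact p.Prime]

/-- **Moving the dilation onto the test function**: for integrable `g`, `0 < a ≤ b`, `s ∈ ℝ` and a Hilbert basis
`(f_i)` of `L²(ℝ)_ev`, `⟨f_i, ϑ(g) Q (Q ϑ_s f_i)⟩ = ⟨f'_i, ϑ(g(· − s)) Q f'_i⟩` with `f' = f.scalingConj (−s)`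
(`Q² = Q`, `ϑ(g) Q ϑ_s = ϑ_{−(−s)} (ϑ_s ϑ(g) Q) ϑ_{−s}`… i.e. conjugation by `ϑ_{−s}`, and `ϑ_s ϑ(g) = ϑ(g(· − s))`). [cite: Connes1999, §VII proof of Thm 4 eqs. (29)–(33) (arXiv p0013); ConnesConsani2021, §4 eq. (40) p. 15] -/
theorem inner_scalingOp_shellProj_scalingUnitary_eq {g : ℝ → ℂ} (hg : Integrable g) {a b : ℝ} (hab : a ≤ b)
    (s : ℝ) {ι : Type*} (f : HilbertBasis ι ℂ (evenPart : Submodule ℂ (Lp ℂ 2 (volume : Measure ℝ)))) (i : ι) :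
    ⟪((f i : evenPart) : Lp ℂ 2 (volume : Measure ℝ)),
        (scalingOp g ∘L (shellProj a b ∘L (shellProj a b ∘L scalingUnitary s)))
          ((f i : evenPart) : Lp ℂ 2 (volume : Measure ℝ))⟫_ℂ =
      ⟪((f.scalingConj (-s) i : evenPart) : Lp ℂ 2 (volume : Measure ℝ)),
        (scalingOp (fun τ => g (τ - s)) ∘L shellProj a b)
          ((f.scalingConj (-s) i : evenPart) : Lp ℂ 2 (volume : Measure ℝ))⟫_ℂ := by
  -- `ϑ(g) Q Q ϑ_s = ϑ_{−s} (ϑ_s ϑ(g) Q) ϑ_{s} = ϑ_{−s} X ϑ_{−(−s)}` with `X = ϑ(g(·−s)) Q`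
  have hQQ : shellProj a b ∘L (shellProj a b ∘L scalingUnitary s) = shellProj a b ∘L scalingUnitary s := by
    rw [← ContinuousLinearMap.comp_assoc]
    change (shellProj a b * shellProj a b) ∘L scalingUnitary s = _
    rw [shellProj_mul_self hab]
  have hX : scalingOp g ∘L (shellProj a b ∘L scalingUnitary s) =
      scalingUnitary (-s) * (scalingOp (fun τ => g (τ - s)) ∘L shellProj a b) * scalingUnitary (-(-s)) := by
    rw [neg_neg, ← scalingUnitary_comp_scalingOp hg s]
    change _ = scalingUnitary (-s) ∘L ((scalingUnitary s ∘L scalingOp g) ∘L shellProj a b) ∘L scalingUnitary s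
    rw [← ContinuousLinearMap.comp_assoc, ← ContinuousLinearMap.comp_assoc, ← ContinuousLinearMap.comp_assoc]
    change _ = ((scalingUnitary (-s) * scalingUnitary s) ∘L scalingOp g) ∘L shellProj a b ∘L scalingUnitary s
    rw [scalingUnitary_neg_mul, ContinuousLinearMap.one_def, ContinuousLinearMap.id_comp,
      ContinuousLinearMap.comp_assoc]
  rw [hQQ, hX, inner_conj_scalingUnitary_eq]

/-- **Hypothesis (V) of `Connes1999_thm_VII_4_rat_singleton_of_offShell` from the classical trace value.**
If for every `s ∈ ℝ` and every Hilbert basis `(e_i)` of `L²(ℝ)_ev` the diagonal series of `ϑ(g(· − s)) Q₀`,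
`Q₀ = Q_{1/p, 1}`, has the value `log p · g(−s)` (`= log(b/a) · h(0)` for `h = g(· − s)`), then
`Σ_i ⟨f_i, (ϑ(g) ∘ Q₀ ∘ (Q₀ ∘ ϑ_{m log p})) f_i⟩ = log p · g(−m log p)` for all `m ∈ ℤ` and all Hilbert bases
`(f_i)`. [cite: Connes1999, §VII Thm 4 and proof eqs. (29)–(33) (arXiv p0013)] -/
theorem annulusValue_of_traceValue {g : ℝ → ℂ} (hg : Integrable g)
    (hT : ∀ (s : ℝ) (ι : Type) (e : HilbertBasis ι ℂ (evenPart : Submodule ℂ (Lp ℂ 2 (volume : Measure ℝ)))),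
      ∑' i, ⟪((e i : evenPart) : Lp ℂ 2 (volume : Measure ℝ)),
        (scalingOp (fun τ => g (τ - s)) ∘L shellProj (p : ℝ)⁻¹ 1) ((e i : evenPart) : Lp ℂ 2 (volume : Measure ℝ))⟫_ℂ =
        (Real.log p : ℂ) * g (-s))
    (m : ℤ) (ι : Type) (f : HilbertBasis ι ℂ (evenPart : Submodule ℂ (Lp ℂ 2 (volume : Measure ℝ)))) :
    ∑' i, ⟪((f i : evenPart) : Lp ℂ 2 (volume : Measure ℝ)),
        (scalingOp g ∘L (shellProj (p : ℝ)⁻¹ 1 ∘L (annulusProj p 1 ∘L scalingUnitary (m * Real.log p))))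
          ((f i : evenPart) : Lp ℂ 2 (volume : Measure ℝ))⟫_ℂ = (Real.log p : ℂ) * g (-(m * Real.log p)) := by
  have hab : (p : ℝ)⁻¹ ≤ 1 := inv_le_one_of_one_le₀ (by exact_mod_cast hp.out.one_lt.le)
  have hQ : annulusProj p 1 = shellProj (p : ℝ)⁻¹ 1 := by
    rw [annulusProj_eq_shellProj, one_div]
  rw [hQ]
  simp_rw [inner_scalingOp_shellProj_scalingUnitary_eq hg hab (m * Real.log p) f]
  exact hT (m * Real.log p) ι (f.scalingConj (-(m * Real.log p)))

end Literature.NumberTheory.Connes2026
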